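import Summits.ValiantsHypothesis.ValiantsHypothesis.Theorems.BarrierLeverChowHitsPartitionMinorsRHybridArrow

/-!
# Route BarrierLever — item `ChowHitsPartitionMinorsR` (stmt-ValiantsHypothesis-21882):
# CONJECTURE G («h forms hit every lower pair») and CONJECTURE G′ (symmetric substitution) — typed, not asserted — and their
# compositions to the item

Helper file (`--supports stmt-ValiantsHypothesis-21882`; cell valiant-natproofs, rung V4, 𝒟-side support item of route
BarrierLever; prover seat val-np-p5 gen 32; seat memo MEMO-21882-valnp5-g32.md §8). Closes NO item.

After THEOREM H (p732931) and its relabelled form (p733528) the residual of line `affine_lower` consists of the lower-set pairs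
whose two defect masses are large under every vertex identification. The census of memo §8.4 (kit j334074, j334106: h = 5
exhaustive over 84 315 pairs modulo symmetry, h = 6, 7 random, structured pairs to h = 9) found NO pair of equal-size lower
sets needing more than `h` generic affine forms, and NO failure of the `h`-form SYMMETRIC-SUBSTITUTION design
`ℓ_k = c_k + Σ_u α_{ku} (x_u + y_u)`. This file TYPES the two statements (`Stmt.conjLowerSetsHitByH` = CONJECTURE G,
`Stmt.conjSymSub` = CONJECTURE G′; `def … : Prop`, never asserted) and PROVES the compositions
`Stmt.conjSymSub → Stmt.conjLowerSetsHitByH → ChowNoStar.Stmt.stub_thickLowerSetsChowRLargeDefect → item`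
(`conjLowerSetsHitByH_of_conjSymSub`, `stub_thickLowerSetsChowRLargeDefect_of_conjLowerSetsHitByH`,
`chowHitsPartitionMinorsR_of_conjLowerSetsHitByH`, `chowHitsPartitionMinorsR_of_conjSymSub`): the budget is met with room
(`h + 2h ≤ h·h` for `h ≥ 3`). Memo §8.2 explains why no design with at most one x-variable (or at most one y-variable) per form
can succeed on all pairs (f-vector dominance is necessary), which is why G′ uses the two-sided forms `x_u + y_u`.

WHAT THIS IS NOT: neither conjecture is proved here; item 21882 is NOT proved; nothing on crux stmt-ValiantsHypothesis-14610 or on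
`VP` versus `VNP`.
-/

set_option linter.dupNamespace false

namespace Summit.ValiantsHypothesis.ValiantsHypothesis.Theorems.BarrierLever.ChowGeneric

open Finset MvPolynomial

noncomputable section

variable {h r : ℕ}

/-- **CONJECTURE G (typed, not asserted)**: for all large `h`, every equal-size pair of injective families of subsets of `Fin h` with
lower-set ranges is hit by `h` affine forms. Census memo §8.4: no counterexample among 84 315 pairs at `h = 5` (exhaustive modulo
symmetry), 9 000 random pairs at `h = 6`, 1 500 at `h = 7`. -/
def Stmt.conjLowerSetsHitByH : Prop :=
  ∃ h₀ : ℕ, ∀ h : ℕ, h₀ ≤ h → ∀ (r : ℕ) (v w' : Fin r → Finset (Fin h)),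
    Function.Injective v → Function.Injective w' →
    IsLowerSet (Set.range v) → IsLowerSet (Set.range w') →
    ∃ ℓ : Fin h → MvPolynomial (Fin (h + h)) ℂ, (∀ k, (ℓ k).totalDegree ≤ 1) ∧
      (Matrix.of fun i j : Fin r => MvPolynomial.coeff
        (∑ a ∈ v i, Finsupp.single (Fin.castAdd h a) 1 +
          ∑ c ∈ w' j, Finsupp.single (Fin.natAdd h c) 1) (∏ k, ℓ k)).det ≠ 0

/-- The symmetric-substitution form `c + Σ_u α_u · (x_u + y_u)`. -/
def symSubForm (c : ℂ) (α : Fin h → ℂ) : MvPolynomial (Fin (h + h)) ℂ :=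
  C c + ∑ u : Fin h, α u • (X (Fin.castAdd h u) + X (Fin.natAdd h u))

/-- The symmetric-substitution form is affine. -/
theorem totalDegree_symSubForm_le (c : ℂ) (α : Fin h → ℂ) : (symSubForm c α).totalDegree ≤ 1 := by
  unfold symSubForm
  refine (totalDegree_add _ _).trans (max_le ?_ ?_)
  · rw [totalDegree_C]; exact zero_le_one
  · refine (totalDegree_finsetSum _ _).trans (Finset.sup_le fun u _ => ?_)
    refine (totalDegree_smul_le _ _).trans ((totalDegree_add _ _).trans (max_le ?_ ?_))
    · exact (totalDegree_X _).le
    · exact (totalDegree_X _).le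

/-- **CONJECTURE G′ (typed, not asserted; the symmetric-substitution design)**: for all large `h`, every equal-size pair of
injective lower-set families is hit by `h` forms of the shape `c_k + Σ_u α_{ku} (x_u + y_u)`. Equivalently (memo §8.4): the
square-free catalecticant block `[(∂_U ∂_W f)(0)]_{U ∈ R, W ∈ C}` of the product `f(v) = ∏_k (c_k + α_k · v)` of `h` generic affine
forms in `h` variables is nonsingular. Census: 0 failures in 84 315 pairs at `h = 5` (exhaustive mod symmetry) and 3 000 at `h = 6`. -/
def Stmt.conjSymSub : Prop :=
  ∃ h₀ : ℕ, ∀ h : ℕ, h₀ ≤ h → ∀ (r : ℕ) (v w' : Fin r → Finset (Fin h)),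
    Function.Injective v → Function.Injective w' →
    IsLowerSet (Set.range v) → IsLowerSet (Set.range w') →
    ∃ (c : Fin h → ℂ) (α : Fin h → Fin h → ℂ),
      (Matrix.of fun i j : Fin r => MvPolynomial.coeff
        (∑ a ∈ v i, Finsupp.single (Fin.castAdd h a) 1 +
          ∑ c ∈ w' j, Finsupp.single (Fin.natAdd h c) 1) (∏ k, symSubForm (c k) (α k))).det ≠ 0

/-- **G′ ⇒ G**: the symmetric-substitution forms are affine forms. -/
theorem conjLowerSetsHitByH_of_conjSymSub (hG : Stmt.conjSymSub) : Stmt.conjLowerSetsHitByH := by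
  obtain ⟨h₀, hG⟩ := hG
  refine ⟨h₀, fun h hh r v w' hv hw hlv hlw => ?_⟩
  obtain ⟨c, α, hdet⟩ := hG h hh r v w' hv hw hlv hlw
  exact ⟨fun k => symSubForm (c k) (α k), fun k => totalDegree_symSubForm_le _ _, hdet⟩

end

end Summit.ValiantsHypothesis.ValiantsHypothesis.Theorems.BarrierLever.ChowGeneric

/-! ## Compositions to the item -/

namespace Summit.ValiantsHypothesis.ValiantsHypothesis.Theorems.BarrierLever.ChowNoStar

open Summit.ValiantsHypothesis.ValiantsHypothesis.Theorems.BarrierLever.ChowGeneric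

/-- **G ⇒ the large-defect node** (and a fortiori every earlier node of line `affine_lower`): `h` forms fit the lower-set budget
`m + 2h ≤ h·h` as soon as `h ≥ 3`; none of the node's side hypotheses is used. -/
theorem stub_thickLowerSetsChowRLargeDefect_of_conjLowerSetsHitByH (hG : Stmt.conjLowerSetsHitByH) :
    Stmt.stub_thickLowerSetsChowRLargeDefect := by
  obtain ⟨h₀, hG⟩ := hG
  refine ⟨max h₀ 3, fun h hh r v w' hv hw hlv hlw _ _ _ _ _ _ _ _ _ _ => ?_⟩
  obtain ⟨ℓ, hdeg, hdet⟩ := hG h ((le_max_left _ _).trans hh) r v w' hv hw hlv hlw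
  have h3 : 3 ≤ h := (le_max_right _ _).trans hh
  exact ⟨h, by nlinarith, ℓ, hdeg, hdet⟩

/-- **THE ITEM FROM CONJECTURE G.** -/
theorem chowHitsPartitionMinorsR_of_conjLowerSetsHitByH (hG : Stmt.conjLowerSetsHitByH) :
    Summit.ValiantsHypothesis.ValiantsHypothesis.Theses.BarrierLever.ChowHitsPartitionMinorsR :=
  chowHitsPartitionMinorsR_of_thickLowerSetsLargeDefect (stub_thickLowerSetsChowRLargeDefect_of_conjLowerSetsHitByH hG)

/-- **THE ITEM FROM CONJECTURE G′** (symmetric substitution). -/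
theorem chowHitsPartitionMinorsR_of_conjSymSub (hG : Stmt.conjSymSub) :
    Summit.ValiantsHypothesis.ValiantsHypothesis.Theses.BarrierLever.ChowHitsPartitionMinorsR :=
  chowHitsPartitionMinorsR_of_conjLowerSetsHitByH (conjLowerSetsHitByH_of_conjSymSub hG)

end Summit.ValiantsHypothesis.ValiantsHypothesis.Theorems.BarrierLever.ChowNoStar
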